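import Summits.Ventures.PercRepro.C026C028Recursion
import Summits.Ventures.PercRepro.C026ProbeTransfer

/-!
# Parallel reduction (p6, gen 15)

Two edges `e`, `g` with the same ends act, for every connection, as one edge open with probability
`1 − (1 − p e)(1 − p g)`: every row under `p` equals the row under `p[e:=0][g := 1 − (1 − p e)(1 − p g)]`
(`law3_parallel`).  The reduced weight vector has one fractional edge fewer (`card_fracEdges_parallel_lt`),
so in the one-edge induction for C-028(c) a fractional edge parallel to another one is free
(`C028At_parallel`).
-/

namespace PercRepro

open Finset

namespace MultiGraph

variable {V E : Type*} (G : MultiGraph V E) [Fintype E] [DecidableEq E]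

omit [Fintype E] in
/-- Opening either of two parallel edges gives the same connections. -/
theorem conn_update_true_parallel {e g : E}
    (hpar : (G.fst g = G.fst e ∧ G.snd g = G.snd e) ∨ (G.fst g = G.snd e ∧ G.snd g = G.fst e))
    (ω : Config E) (u v : V) :
    G.Conn (Function.update ω e true) u v ↔ G.Conn (Function.update ω g true) u v := by
  rw [conn_update_true_iff, conn_update_true_iff]
  rcases hpar with ⟨h1, h2⟩ | ⟨h1, h2⟩
  · rw [h1, h2]
  · rw [h1, h2]
    tauto

/-- The rows with `e` forced open equal the rows with `g` forced open, for parallel `e`, `g`. -/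
theorem law3_update_one_parallel (p : E → ℝ) {e g : E}
    (hpar : (G.fst g = G.fst e ∧ G.snd g = G.snd e) ∨ (G.fst g = G.snd e ∧ G.snd g = G.fst e))
    (a b c : V) (s : Fin 5) :
    G.law3 (Function.update p e 1) a b c s = G.law3 (Function.update p g 1) a b c s := by
  unfold law3
  rw [prob_update_one_eq_prob_lift, prob_update_one_eq_prob_lift]
  congr 1
  ext ω
  simp only [mem_lift, G.mem_partitionEvent_three a b c, G.conn_update_true_parallel hpar ω]

/-- With `e` surely open, its parallel edge `g` is irrelevant: the rows of `p[e:=1][g:=1]` and of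
`p[e:=1][g:=0]` agree. -/
theorem law3_update_parallel_irrelevant {p : E → ℝ} (hp : IsProb p) {e g : E} (heg : e ≠ g)
    (hpar : (G.fst g = G.fst e ∧ G.snd g = G.snd e) ∨ (G.fst g = G.snd e ∧ G.snd g = G.fst e))
    (a b c : V) (s : Fin 5) :
    G.law3 (Function.update (Function.update p e 1) g 1) a b c s =
      G.law3 (Function.update (Function.update p e 1) g 0) a b c s := by
  have hp1 : IsProb (Function.update p e 1) := hp.update e ⟨zero_le_one, le_rfl⟩
  unfold law3
  rw [prob_update_one_eq_prob_lift, prob_update_zero_eq_prob_lift]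
  refine prob_eq_of_eqOn_pos hp1 fun ω hω => ?_
  have hopen : ω e = true := eq_true_of_weight_pos hω (by simp)
  have hidem : Function.update ω g true =
      Function.update (Function.update ω g false) g true := by
    rw [Function.update_idem]
  have hge : Function.update ω g false e = true := by
    rw [Function.update_of_ne heg]; exact hopen
  have hxy : G.Conn (Function.update ω g false) (G.fst g) (G.snd g) := by
    have h := Conn.of_openAdj (G.openAdj_of_open e hge)
    rcases hpar with ⟨h1, h2⟩ | ⟨h1, h2⟩
    · rw [h1, h2]; exact h
    · rw [h1, h2]; exact h.symm
  simp only [mem_lift, G.mem_partitionEvent_three a b c, hidem,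
    G.conn_update_true_iff_of_conn_endpoints hxy]

/-- **Parallel reduction of the rows**: `law3 p = law3 (p[e:=0][g := 1 − (1 − p e)(1 − p g)])` for
parallel `e`, `g`. -/
theorem law3_parallel_reduce {p : E → ℝ} (hp : IsProb p) {e g : E} (heg : e ≠ g)
    (hpar : (G.fst g = G.fst e ∧ G.snd g = G.snd e) ∨ (G.fst g = G.snd e ∧ G.snd g = G.fst e))
    (a b c : V) (s : Fin 5) :
    G.law3 p a b c s =
      G.law3 (Function.update (Function.update p e 0) g (1 - (1 - p e) * (1 - p g))) a b c s := by
  have hsplitE := G.law3_split_edge p e a b c s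
  have hsplitG1 := G.law3_split_edge (Function.update p e 1) g a b c s
  have hsplitG0 := G.law3_split_edge (Function.update p e 0) g a b c s
  have hsplitG' := G.law3_split_edge
    (Function.update (Function.update p e 0) g (1 - (1 - p e) * (1 - p g))) g a b c s
  rw [Function.update_idem, Function.update_idem, Function.update_self] at hsplitG'
  rw [Function.update_of_ne heg.symm] at hsplitG0 hsplitG1
  have hpar' : (G.fst e = G.fst g ∧ G.snd e = G.snd g) ∨ (G.fst e = G.snd g ∧ G.snd e = G.fst g) := by
    rcases hpar with ⟨h1, h2⟩ | ⟨h1, h2⟩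
    · exact Or.inl ⟨h1.symm, h2.symm⟩
    · exact Or.inr ⟨h2.symm, h1.symm⟩
  have hirr_e := G.law3_update_parallel_irrelevant hp heg hpar a b c s
  have hirr_g := G.law3_update_parallel_irrelevant hp heg.symm hpar' a b c s
  rw [Function.update_comm heg.symm, Function.update_comm heg.symm] at hirr_g
  rw [hsplitG', hsplitE, hsplitG1, hsplitG0, hirr_e, ← hirr_g, hirr_e]
  ring

/-- The parallel-reduced weight vector has the fractional edges of `p` minus `e` (when `g` is
fractional). -/
theorem fracEdges_parallel_subset (p : E → ℝ) {e g : E} (heg : e ≠ g) (hg0 : p g ≠ 0)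
    (hg1 : p g ≠ 1) (he0 : p e ≠ 0) (he1 : p e ≠ 1) :
    fracEdges (Function.update (Function.update p e 0) g (1 - (1 - p e) * (1 - p g))) ⊆
      (fracEdges p).erase e := by
  intro e' he'
  simp only [fracEdges, Finset.mem_filter, Finset.mem_univ, true_and] at he'
  by_cases h1 : e' = g
  · subst h1
    simp only [Finset.mem_erase, fracEdges, Finset.mem_filter, Finset.mem_univ, true_and]
    exact ⟨heg.symm, hg0, hg1⟩
  · rw [Function.update_of_ne h1] at he'
    by_cases h2 : e' = e
    · subst h2
      rw [Function.update_self] at he'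
      exact absurd rfl he'.1
    · rw [Function.update_of_ne h2] at he'
      simp only [Finset.mem_erase, fracEdges, Finset.mem_filter, Finset.mem_univ, true_and]
      exact ⟨h2, he'⟩

/-- The parallel reduction strictly decreases the number of fractional edges. -/
theorem card_fracEdges_parallel_lt {p : E → ℝ} {e g : E} (heg : e ≠ g) (he : e ∈ fracEdges p)
    (hg : g ∈ fracEdges p) :
    (fracEdges (Function.update (Function.update p e 0) g (1 - (1 - p e) * (1 - p g)))).card <
      (fracEdges p).card := by
  have he' := he
  have hg' := hg
  simp only [fracEdges, Finset.mem_filter, Finset.mem_univ, true_and] at he' hg'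
  exact lt_of_le_of_lt
    (Finset.card_le_card (fracEdges_parallel_subset p heg hg'.1 hg'.2 he'.1 he'.2))
    (Finset.card_erase_lt_of_mem he)

/-- **C-028(c) through a parallel pair**: C-028(c) at the parallel-reduced weights gives C-028(c)
at `p`. -/
theorem C028At_parallel {p : E → ℝ} (hp : IsProb p) {e g : E} (heg : e ≠ g)
    (hpar : (G.fst g = G.fst e ∧ G.snd g = G.snd e) ∨ (G.fst g = G.snd e ∧ G.snd g = G.fst e))
    {a b c : V}
    (h : G.C028At (Function.update (Function.update p e 0) g (1 - (1 - p e) * (1 - p g))) a b c) :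
    G.C028At p a b c := by
  have hr := G.law3_parallel_reduce hp heg hpar a b c
  unfold C028At c028Cov at h ⊢
  rw [hr 0, hr 1, hr 2, hr 3]
  exact h

end MultiGraph

end PercRepro
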